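import Literature.Probability.LatticeModels.TwoCurrentClusterCalculus
import Literature.Probability.LatticeModels.UrsellSeriesAlgebra
import HarnessLib

/-!
# The cluster expansion of Ising Ursell functions, I: the rooted family identity

Topic `Literature/Probability/LatticeModels`; continues `TwoCurrentClusterCalculus` (the two-current cluster
identity (†') `⟨σ_𝒯⟩⟨σ_𝒮⟩ = Σ_A ρI_A(…) ⟨·⟩_A ⟨·⟩_A`) and `UrsellSeriesAlgebra` (square-free series).  For edge
couplings `K ≥ 0` on a finite simple graph we set

* `uK K B = ursellOf ⟨σ_·⟩_K B` — the Ursell function of the correlations `⟨σ_B⟩_K = Z_K[B]/Z_K[∅]`;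
* `dU K A B = u_K(B) - u_{K_A}(B)` — its variation when the couplings meeting `A` are cut off (`K_A = cutCoupling K A`;
  `u_{K_A}(B) = 0` as soon as `B` meets `A`);
* `eA K A c = exp(-c · dU K A ·)` — the set-partition exponential of `-c·dU`;
* `cw K u A B = 𝟙[B ⊆ A] ρI_A(B)` — the normalised weight of the cluster `A ∋ u` carrying the sources `B`.

The main result of this file is the **rooted family identity** `Current.familyA` (evidence "full_proof.md", Thm A'
with `P = {w₀}`, `Q = ∅`): for `w₀ ∉ U ∪ U'`, `U ∩ U' = ∅`,

  `𝟙[U' = ∅] u(U + w₀) = Σ_A Σ_{S ⊆ U} Σ_{E ⊆ U', #E even} cw_A(w₀ + S + E) · e_A(U ∖ S) · e_A(U' ∖ E)`,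

obtained from (†') by convolving with the inverse `exp(-u)` of the moment series in both variables
(`Current.deconv₂`).  Its diagonal collapse gives Shlosman's sign recursion (`UrsellSignRecursion`).  On the way:
parity and support vanishing of `u`, `exp(u_K) = ⟨σ⟩_K`, `e_A ⋆ ⟨σ⟩_K = ⟨σ⟩_{K_A}`, and the block recursion.
Nothing here is a named fact.

## References

* S. B. Shlosman, Comm. Math. Phys. 102 (1986) 679–686 (signs of Ursell functions) [Shlosman1986];
  F. Camia, J. Jiang, C. M. Newman, Comm. Math. Phys. 401 (2023), arXiv:2207.12247 [CamiaJiangNewman2023];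
  M. Aizenman, Comm. Math. Phys. 86 (1982), §5 [AizenmanCMP1982] — the random-current cluster conditioning.
-/

noncomputable section

open Finset Filter
open scoped symmDiff ENNReal

namespace Literature.Probability.LatticeModels

/-! ### Generic complements to `UrsellSeriesAlgebra` -/

section Generic

variable {α : Type*} [DecidableEq α] {C : Type*} [CommRing C]

/-- `⋆` only sees the first factor on subsets. [folklore] -/
theorem spConv_congr_left {f f' : Finset α → C} (g : Finset α → C) {Y : Finset α}
    (h : ∀ Z ⊆ Y, f Z = f' Z) : spConv f g Y = spConv f' g Y :=
  sum_congr rfl fun Z hZ => by rw [h Z (mem_powerset.1 hZ)]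

/-- Finite sums pull out of the first slot of `⋆`. [folklore] -/
theorem spConv_sum_left {ι : Type*} (s : Finset ι) (f : ι → Finset α → C) (g : Finset α → C) (Y : Finset α) :
    spConv (fun Z => ∑ i ∈ s, f i Z) g Y = ∑ i ∈ s, spConv (f i) g Y := by
  simp only [spConv, sum_mul]
  rw [sum_comm]

/-- **Deconvolution**: if `f ⋆ M = f' ⋆ M` on all subsets of `Y` and `M` has a `⋆`-inverse `N` (`M ⋆ N = 1`),
then `f Y = f' Y`. [folklore] -/
theorem deconv {f f' M N : Finset α → C} (hMN : ∀ Z, spConv M N Z = spOne Z) {Y : Finset α}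
    (h : ∀ Z ⊆ Y, spConv f M Z = spConv f' M Z) : f Y = f' Y := by
  have key : ∀ g : Finset α → C, g Y = spConv (spConv g M) N Y := fun g => by
    rw [spConv_assoc, ← spConv_spOne_right g Y]
    congr 1
    funext Z
    rw [hMN Z]
  rw [key f, key f', spConv_congr_left N h]

/-- **Deconvolution in two variables.** [folklore] -/
theorem deconv₂ {F F' : Finset α → Finset α → C} {M N : Finset α → C} (hMN : ∀ Z, spConv M N Z = spOne Z)
    {U U' : Finset α}
    (h : ∀ Z ⊆ U, ∀ Z' ⊆ U', spConv (fun Y => spConv (F Y) M Z') M Z = spConv (fun Y => spConv (F' Y) M Z') M Z) :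
    F U U' = F' U U' := by
  have h1 : ∀ Z' ⊆ U', spConv (F U) M Z' = spConv (F' U) M Z' := fun Z' hZ' =>
    deconv (f := fun Y => spConv (F Y) M Z') (f' := fun Y => spConv (F' Y) M Z') hMN fun Z hZ => h Z hZ Z' hZ'
  exact deconv hMN h1

/-- **Support collapse**: if `f` lives on subsets of `A` and `g` on sets avoiding `A`, the convolution has the single
term `S = Z ∩ A`. [folklore] -/
theorem sum_powerset_mul_eq_filter (A : Finset α) {f g : Finset α → C} {Z : Finset α}
    (hf : ∀ S ⊆ Z, ¬ S ⊆ A → f S = 0) (hg : ∀ R ⊆ Z, ¬ Disjoint R A → g R = 0) :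
    ∑ S ∈ Z.powerset, f S * g (Z \ S) = f (Z.filter (· ∈ A)) * g (Z.filter (· ∉ A)) := by
  have hmem : Z.filter (· ∈ A) ∈ Z.powerset := mem_powerset.2 (filter_subset _ _)
  rw [sum_eq_single_of_mem _ hmem]
  · congr 1
    rw [sdiff_eq_filter]
    refine congr_arg g (filter_congr fun x hx => ?_)
    simp [hx]
  · intro S hS hne
    have hSZ := mem_powerset.1 hS
    by_cases hSA : S ⊆ A
    · -- some point of `Z ∩ A` is missing from `S`, so `Z \ S` meets `A`
      have : ¬ Disjoint (Z \ S) A := by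
        intro hd
        apply hne
        ext x
        simp only [mem_filter]
        constructor
        · exact fun hx => ⟨hSZ hx, hSA hx⟩
        · rintro ⟨hxZ, hxA⟩
          by_contra hxS
          exact disjoint_left.1 hd (mem_sdiff.2 ⟨hxZ, hxS⟩) hxA
      rw [hg _ sdiff_subset this, mul_zero]
    · rw [hf S hSZ hSA, zero_mul]

/-- **Hereditary vanishing of Ursell functions**: if `m` vanishes on the "bad" sets and every set partition of a bad
set has a bad block, then `mᵀ` vanishes on the nonempty bad sets. [folklore] -/
theorem ursellOf_eq_zero_of_hereditary (m : Finset α → C) (Bad : Finset α → Prop) (hm : ∀ Y, Bad Y → m Y = 0)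
    (hher : ∀ Y, Bad Y → ∀ π ∈ setPartitions Y, ∃ P ∈ π, Bad P) {Y : Finset α} (hY : Bad Y) :
    ursellOf m Y = 0 := by
  induction Y using Finset.strongInduction with
  | H Y ih =>
    rw [ursellOf_eq, hm Y hY, zero_sub, neg_eq_zero]
    refine sum_eq_zero fun π hπ => ?_
    obtain ⟨hne, hπ'⟩ := mem_erase.1 hπ
    obtain ⟨P, hP, hPbad⟩ := hher Y hY π hπ'
    have hsp := mem_setPartitions.1 hπ'
    exact prod_eq_zero hP (ih P (hsp.ssubset_of_ne_singleton hne hP) hPbad)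

/-- **Hereditary vanishing of the exponential**: if `h` vanishes on the bad blocks and every set partition of a bad
set has a bad block, then `exp h` vanishes on the bad sets. [folklore] -/
theorem spExp_eq_zero_of_hereditary (h : Finset α → C) (Bad : Finset α → Prop) (hh : ∀ Y, Bad Y → h Y = 0)
    (hher : ∀ Y, Bad Y → ∀ π ∈ setPartitions Y, ∃ P ∈ π, Bad P) {Y : Finset α} (hY : Bad Y) :
    spExp h Y = 0 := by
  refine sum_eq_zero fun π hπ => ?_
  obtain ⟨P, hP, hPbad⟩ := hher Y hY π hπ
  exact prod_eq_zero hP (hh P hPbad)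

/-- A set partition of a set of odd size has a block of odd size. [folklore] -/
theorem exists_odd_block {Y : Finset α} (hY : Odd #Y) {π : Finset (Finset α)} (hπ : π ∈ setPartitions Y) :
    ∃ P ∈ π, Odd #P := by
  by_contra hall
  have hall' : ∀ P ∈ π, Even #P := fun P hP => Nat.not_odd_iff_even.1 fun hodd => hall ⟨P, hP, hodd⟩
  have hsum := (mem_setPartitions.1 hπ).sum_card
  have heven : Even (∑ P ∈ π, #P) := even_sum _ fun P hP => hall' P hP
  rw [hsum] at heven
  exact (Nat.not_even_iff_odd.2 hY) heven

/-- A set partition of a set meeting `A` has a block meeting `A`. [folklore] -/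
theorem exists_block_not_disjoint {Y A : Finset α} (hY : ¬ Disjoint Y A) {π : Finset (Finset α)}
    (hπ : π ∈ setPartitions Y) : ∃ P ∈ π, ¬ Disjoint P A := by
  obtain ⟨x, hxY, hxA⟩ := not_disjoint_iff.1 hY
  obtain ⟨P, hP, hxP⟩ := (mem_setPartitions.1 hπ).exists_mem hxY
  exact ⟨P, hP, not_disjoint_iff.2 ⟨x, hxP, hxA⟩⟩

end Generic

/-! ### The Ursell set functions of a weighted current model -/

variable {V : Type*} [Fintype V] [DecidableEq V] {G : SimpleGraph V} [DecidableRel G.Adj]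

namespace Current

variable {K : G.edgeFinset → ℝ}

/-- The Ursell function of the correlations `⟨σ_·⟩_K = Z_K[·]/Z_K[∅]`. [cite: CamiaJiangNewman2023, §1.1 eq. (2)] -/
def uK (K : G.edgeFinset → ℝ) (B : Finset V) : ℝ := ursellOf (corrK K) B

/-- The variation `δ_A u(B) = u_K(B) - u_{K_A}(B)` under cutting the couplings meeting `A`. [cite: Shlosman1986, §2] -/
def dU (K : G.edgeFinset → ℝ) (A B : Finset V) : ℝ := uK K B - uK (cutCoupling K A) B

/-- `e_A^{(c)} = exp(-c · δ_A u)` (set-partition exponential). [cite: Shlosman1986, §2] -/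
def eA (K : G.edgeFinset → ℝ) (A : Finset V) (c : ℝ) : Finset V → ℝ := spExp fun B => -(c * dU K A B)

/-- The cluster weight `cw_A(B) = 𝟙[B ⊆ A] ρI_A(B)`. [cite: AizenmanCMP1982, §5 (conditioning on clusters)] -/
def cw (K : G.edgeFinset → ℝ) (u : V) (A B : Finset V) : ℝ := if B ⊆ A then rhoI K u A B else 0

/-- `⟨σ_∅⟩ = 1`. [folklore] -/
theorem corrK_empty (hK : ∀ e, 0 ≤ K e) : corrK K (∅ : Finset V) = 1 :=
  div_self (wcurrentSum_empty_pos hK).ne'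

/-- Odd correlations vanish. [folklore] -/
theorem corrK_eq_zero_of_odd (K : G.edgeFinset → ℝ) {B : Finset V} (hB : Odd #B) : corrK K B = 0 := by
  rw [corrK, wcurrentSum_eq_zero_of_odd K hB, zero_div]

/-- In the model with the couplings at `A` cut off, correlations of sets meeting `A` vanish (a current supported off `A`
has no source in `A`). [folklore] -/
theorem wcurrentSum_cutCoupling_eq_zero (K : G.edgeFinset → ℝ) {A B : Finset V} (hB : ¬ Disjoint B A) :
    wcurrentSum (cutCoupling K A) B = 0 := by
  unfold wcurrentSum
  refine (tsum_congr fun n => ?_).trans tsum_zero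
  by_cases hs : n.sources = B
  · rw [if_pos hs, wweight_cutCoupling]
    by_cases hsupp : IsSupp (offGraph G A) n
    · exact absurd (hs ▸ disjoint_sources_of_isSupp_offGraph hsupp) hB
    · rw [if_neg hsupp]
  · rw [if_neg hs]

/-- `⟨σ_B⟩_{K_A} = 0` for `B` meeting `A`. [folklore] -/
theorem corrK_cutCoupling_eq_zero (K : G.edgeFinset → ℝ) {A B : Finset V} (hB : ¬ Disjoint B A) :
    corrK (cutCoupling K A) B = 0 := by
  rw [corrK, wcurrentSum_cutCoupling_eq_zero K hB, zero_div]

/-- Ursell functions of odd sets vanish. [folklore] -/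
theorem uK_eq_zero_of_odd (K : G.edgeFinset → ℝ) {B : Finset V} (hB : Odd #B) : uK K B = 0 :=
  ursellOf_eq_zero_of_hereditary (corrK K) (fun Y => Odd #Y) (fun _ h => corrK_eq_zero_of_odd K h)
    (fun _ h _ hπ => exists_odd_block h hπ) hB

/-- `δ_A u` vanishes on odd sets. [folklore] -/
theorem dU_eq_zero_of_odd (K : G.edgeFinset → ℝ) (A : Finset V) {B : Finset V} (hB : Odd #B) : dU K A B = 0 := by
  rw [dU, uK_eq_zero_of_odd K hB, uK_eq_zero_of_odd _ hB, sub_zero]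

/-- `u_{K_A}(B) = 0` for `B` meeting `A`. [folklore] -/
theorem uK_cutCoupling_eq_zero (K : G.edgeFinset → ℝ) {A B : Finset V} (hB : ¬ Disjoint B A) :
    uK (cutCoupling K A) B = 0 :=
  ursellOf_eq_zero_of_hereditary (corrK (cutCoupling K A)) (fun Y => ¬ Disjoint Y A)
    (fun _ h => corrK_cutCoupling_eq_zero K h) (fun _ h _ hπ => exists_block_not_disjoint h hπ) hB

/-- `e_A^{(c)}` vanishes on odd sets. [folklore] -/
theorem eA_eq_zero_of_odd (K : G.edgeFinset → ℝ) (A : Finset V) (c : ℝ) {Y : Finset V} (hY : Odd #Y) :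
    eA K A c Y = 0 :=
  spExp_eq_zero_of_hereditary _ (fun Y => Odd #Y) (fun B hB => by rw [dU_eq_zero_of_odd K A hB]; ring)
    (fun _ h _ hπ => exists_odd_block h hπ) hY

/-- `e_A^{(c)} ∅ = 1`. [folklore] -/
@[simp] theorem eA_empty (K : G.edgeFinset → ℝ) (A : Finset V) (c : ℝ) : eA K A c ∅ = 1 := spExp_empty _

/-- `cw_A(B) = 0` unless `u ∈ A`. [folklore] -/
theorem cw_eq_zero_of_notMem (K : G.edgeFinset → ℝ) {u : V} {A : Finset V} (hu : u ∉ A) (B : Finset V) :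
    cw K u A B = 0 := by
  unfold cw rhoI
  rw [jmass_eq_zero_of_notMem K hu]
  simp

/-- `cw_A(B) = 0` unless `B ⊆ A`. [folklore] -/
theorem cw_eq_zero_of_not_subset (K : G.edgeFinset → ℝ) (u : V) {A B : Finset V} (h : ¬ B ⊆ A) : cw K u A B = 0 :=
  if_neg h

/-- **`exp(u_K) = ⟨σ⟩_K`** (moment–cumulant relation). [cite: CamiaJiangNewman2023, §1.1 eq. (2)] -/
theorem spExp_uK (hK : ∀ e, 0 ≤ K e) (B : Finset V) : spExp (uK K) B = corrK K B :=
  spExp_ursellOf (corrK K) (corrK_empty hK) B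

/-- **`e_A ⋆ ⟨σ⟩_K = ⟨σ⟩_{K_A}`**: `exp(-u + u_A) ⋆ exp(u) = exp(u_A)`. [folklore] -/
theorem spConv_eA_corrK (hK : ∀ e, 0 ≤ K e) (A Y : Finset V) :
    spConv (eA K A 1) (corrK K) Y = corrK (cutCoupling K A) Y := by
  have hM : corrK K = spExp (uK K) := funext fun B => (spExp_uK hK B).symm
  rw [hM, eA, ← spExp_add, ← spExp_uK (cutCoupling_nonneg hK A)]
  congr 1
  funext B
  simp only [Pi.add_apply, dU]
  ring

/-- `⟨σ⟩ ⋆ exp(-u) = 1`. [folklore] -/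
theorem spConv_corrK_spExp_neg (hK : ∀ e, 0 ≤ K e) (Z : Finset V) :
    spConv (corrK K) (spExp (-uK K)) Z = spOne Z := by
  have hM : corrK K = spExp (uK K) := funext fun B => (spExp_uK hK B).symm
  rw [hM, spConv_spExp_neg]

/-- **Block recursion of the correlations at a vertex**: `⟨σ_{Y+v}⟩ = Σ_{Z ⊆ Y} u(Z + v) ⟨σ_{Y∖Z}⟩`. [folklore] -/
theorem sum_powerset_uK_insert_mul (hK : ∀ e, 0 ≤ K e) {v : V} {Y : Finset V} (hv : v ∉ Y) :
    ∑ Z ∈ Y.powerset, uK K (insert v Z) * corrK K (Y \ Z) = corrK K (insert v Y) := by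
  rw [← spExp_uK hK (insert v Y), spExp_insert (uK K) hv]
  exact sum_congr rfl fun Z _ => by rw [spExp_uK hK]

/-- (†') with the cluster weight `cw` (the source set `(𝒯 ∪ 𝒮) ∩ A` lies in `A`). [cite: AizenmanCMP1982, §5 (conditioning on clusters)] -/
theorem corr_mul_corr_eq_sum_cw (hK : ∀ e, 0 ≤ K e) (u : V) {𝒯 𝒮 : Finset V} (hd : Disjoint 𝒯 𝒮) (h𝒮 : Even #𝒮) :
    corrK K 𝒯 * corrK K 𝒮 =
      ∑ A : Finset V, cw K u A ((𝒯 ∪ 𝒮).filter (· ∈ A)) *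
        (corrK (cutCoupling K A) (𝒯.filter (· ∉ A)) * corrK (cutCoupling K A) (𝒮.filter (· ∉ A))) := by
  rw [corr_mul_corr_eq_sum hK u hd h𝒮]
  refine sum_congr rfl fun A _ => ?_
  have hsub : (𝒯 ∪ 𝒮).filter (· ∈ A) ⊆ A := fun v hv => (mem_filter.1 hv).2
  rw [cw, if_pos hsub]

/-! ### The rooted family identity -/

/-- The right-hand side of the rooted family identity: atoms `(A, S, E)` with even `E`. [cite: Shlosman1986, §2] -/
def famARhs (K : G.edgeFinset → ℝ) (w₀ : V) (U U' : Finset V) : ℝ :=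
  ∑ A : Finset V, ∑ S ∈ U.powerset, ∑ E ∈ U'.powerset,
    (if Even #E then cw K w₀ A (insert w₀ (S ∪ E)) else 0) * eA K A 1 (U \ S) * eA K A 1 (U' \ E)

/-- The right-hand side as an iterated convolution. [folklore] -/
theorem famARhs_eq_spConv (K : G.edgeFinset → ℝ) (w₀ : V) (U U' : Finset V) :
    famARhs K w₀ U U' = ∑ A : Finset V,
      spConv (fun S => spConv (fun E => if Even #E then cw K w₀ A (insert w₀ (S ∪ E)) else 0) (eA K A 1) U')
        (eA K A 1) U := by
  unfold famARhs spConv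
  refine sum_congr rfl fun A _ => sum_congr rfl fun S _ => ?_
  rw [sum_mul]
  refine sum_congr rfl fun E _ => ?_
  ring

/-- The double moment transform of the right-hand side: only the atom `S = Z ∩ A`, `E = Z' ∩ A` survives.
[cite: AizenmanCMP1982, §5 (conditioning on clusters)] -/
theorem transform_famARhs (hK : ∀ e, 0 ≤ K e) (w₀ : V) (Z Z' : Finset V) :
    spConv (fun Y => spConv (famARhs K w₀ Y) (corrK K) Z') (corrK K) Z =
      ∑ A : Finset V, (if Even #(Z'.filter (· ∈ A)) then
          cw K w₀ A (insert w₀ (Z.filter (· ∈ A) ∪ Z'.filter (· ∈ A))) else 0) *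
        corrK (cutCoupling K A) (Z'.filter (· ∉ A)) * corrK (cutCoupling K A) (Z.filter (· ∉ A)) := by
  have hfun : ∀ A : Finset V, spConv (eA K A 1) (corrK K) = corrK (cutCoupling K A) :=
    fun A => funext fun R => spConv_eA_corrK hK A R
  -- the coefficient left after the transform in the second variable
  set c : Finset V → Finset V → ℝ := fun A S =>
    (if Even #(Z'.filter (· ∈ A)) then cw K w₀ A (insert w₀ (S ∪ Z'.filter (· ∈ A))) else 0) *
      corrK (cutCoupling K A) (Z'.filter (· ∉ A)) with hc
  -- Step 1: the inner transform in the second variable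
  have inner : ∀ Y, spConv (famARhs K w₀ Y) (corrK K) Z' =
      ∑ A : Finset V, ∑ S ∈ Y.powerset, c A S * eA K A 1 (Y \ S) := by
    intro Y
    have h1 : famARhs K w₀ Y = fun Y' => ∑ A : Finset V, ∑ S ∈ Y.powerset,
        spConv (fun E => (if Even #E then cw K w₀ A (insert w₀ (S ∪ E)) else 0) * eA K A 1 (Y \ S))
          (eA K A 1) Y' := by
      funext Y'
      rfl
    rw [h1, spConv_sum_left]
    refine sum_congr rfl fun A _ => ?_
    rw [spConv_sum_left]
    refine sum_congr rfl fun S _ => ?_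
    rw [spConv_assoc, hfun A]
    have hf : ∀ E ⊆ Z', ¬ E ⊆ A →
        (fun E => (if Even #E then cw K w₀ A (insert w₀ (S ∪ E)) else 0) * eA K A 1 (Y \ S)) E = 0 := by
      intro E _ hEA
      have : ¬ insert w₀ (S ∪ E) ⊆ A := fun h => hEA fun x hx => h (mem_insert_of_mem (mem_union_right _ hx))
      simp only [cw_eq_zero_of_not_subset K w₀ this, ite_self, zero_mul]
    have hg : ∀ R ⊆ Z', ¬ Disjoint R A → (fun R => corrK (cutCoupling K A) R) R = 0 :=
      fun R _ hR => corrK_cutCoupling_eq_zero K hR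
    unfold spConv
    refine (sum_powerset_mul_eq_filter A hf hg).trans ?_
    simp only [hc]
    ring
  -- Step 2: the outer transform in the first variable
  simp only [inner]
  rw [spConv_sum_left]
  refine sum_congr rfl fun A _ => ?_
  have h2 : (fun Y => ∑ S ∈ Y.powerset, c A S * eA K A 1 (Y \ S)) = spConv (c A) (eA K A 1) := rfl
  rw [h2, spConv_assoc, hfun A]
  have hf : ∀ S ⊆ Z, ¬ S ⊆ A → c A S = 0 := by
    intro S _ hSA
    have : ¬ insert w₀ (S ∪ Z'.filter (· ∈ A)) ⊆ A :=
      fun h => hSA fun x hx => h (mem_insert_of_mem (mem_union_left _ hx))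
    simp only [hc, cw_eq_zero_of_not_subset K w₀ this, ite_self, zero_mul]
  have hg : ∀ R ⊆ Z, ¬ Disjoint R A → (fun R => corrK (cutCoupling K A) R) R = 0 :=
    fun R _ hR => corrK_cutCoupling_eq_zero K hR
  unfold spConv
  refine (sum_powerset_mul_eq_filter A hf hg).trans ?_
  simp only [hc]

/-- The double moment transform of the left-hand side `𝟙[U'=∅] u(U+w₀)`: `⟨σ_{Z+w₀}⟩⟨σ_{Z'}⟩`. [folklore] -/
theorem transform_famALhs (hK : ∀ e, 0 ≤ K e) (w₀ : V) {Z : Finset V} (hZ : w₀ ∉ Z) (Z' : Finset V) :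
    spConv (fun Y => spConv (fun Y' => if Y' = ∅ then uK K (insert w₀ Y) else 0) (corrK K) Z') (corrK K) Z =
      corrK K (insert w₀ Z) * corrK K Z' := by
  have inner : ∀ Y, spConv (fun Y' => if Y' = ∅ then uK K (insert w₀ Y) else 0) (corrK K) Z' =
      uK K (insert w₀ Y) * corrK K Z' := by
    intro Y
    have h : (fun Y' : Finset V => if Y' = ∅ then uK K (insert w₀ Y) else 0) =
        fun Y' => uK K (insert w₀ Y) * spOne Y' := by
      funext Y'; unfold spOne; split_ifs <;> simp
    rw [h, spConv_smul_left, spConv_spOne_left]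
  simp only [inner]
  unfold spConv
  rw [← sum_powerset_uK_insert_mul hK hZ, sum_mul]
  exact sum_congr rfl fun Y _ => by ring

/-- **The rooted family identity** (Thm A' of the evidence notes with `P = {w₀}`, `Q = ∅`; the algebraic form of
Shlosman's cluster expansion of `u`): for `w₀ ∉ U ∪ U'`, `U ∩ U' = ∅`,
`𝟙[U' = ∅] u(U + w₀) = Σ_A Σ_{S ⊆ U} Σ_{E ⊆ U', #E even} cw_A(w₀ + S + E) e_A(U ∖ S) e_A(U' ∖ E)`.
Both sides have the same double moment transform `⟨σ_{Z+w₀}⟩⟨σ_{Z'}⟩` (block recursion on the left, support collapse and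
(†') on the right), and the moment series is invertible. [cite: Shlosman1986, §2] -/
theorem familyA (hK : ∀ e, 0 ≤ K e) (w₀ : V) {U U' : Finset V} (hU : w₀ ∉ U) (hU' : w₀ ∉ U') (hd : Disjoint U U') :
    (if U' = ∅ then uK K (insert w₀ U) else 0) = famARhs K w₀ U U' := by
  refine deconv₂ (F := fun Y Y' => if Y' = ∅ then uK K (insert w₀ Y) else (0 : ℝ)) (F' := famARhs K w₀)
    (spConv_corrK_spExp_neg hK) fun Z hZU Z' hZ'U' => ?_
  have hZ : w₀ ∉ Z := fun h => hU (hZU h)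
  have hZ' : w₀ ∉ Z' := fun h => hU' (hZ'U' h)
  rw [transform_famALhs hK w₀ hZ Z', transform_famARhs hK w₀ Z Z']
  rcases Nat.even_or_odd #Z' with hev | hodd
  · -- `#Z'` even: compare with (†') termwise
    have hdisj : Disjoint (insert w₀ Z) Z' :=
      disjoint_insert_left.2 ⟨hZ', disjoint_of_subset_left hZU (disjoint_of_subset_right hZ'U' hd)⟩
    rw [corr_mul_corr_eq_sum_cw hK w₀ hdisj hev]
    refine sum_congr rfl fun A _ => ?_
    by_cases hw : w₀ ∈ A
    · have h1 : (insert w₀ Z ∪ Z').filter (· ∈ A) = insert w₀ (Z.filter (· ∈ A) ∪ Z'.filter (· ∈ A)) := by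
        rw [filter_union, filter_insert, if_pos hw, insert_union]
      have h2 : (insert w₀ Z).filter (· ∉ A) = Z.filter (· ∉ A) := by
        rw [filter_insert, if_neg (not_not.2 hw)]
      rw [h1, h2]
      by_cases hpar : Even #(Z'.filter (· ∈ A))
      · rw [if_pos hpar]; ring
      · have hodd' : Odd #(Z'.filter (· ∉ A)) := by
          have hsum := Finset.card_filter_add_card_filter_not (s := Z') (fun v => v ∈ A)
          rcases hev with ⟨k, hk⟩
          rcases Nat.not_even_iff_odd.1 hpar with ⟨j, hj⟩
          exact Nat.odd_iff.2 (by omega)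
        rw [if_neg hpar, corrK_eq_zero_of_odd _ hodd']; ring
    · rw [cw_eq_zero_of_notMem K hw, cw_eq_zero_of_notMem K hw]
      simp
  · -- `#Z'` odd: both sides vanish
    rw [corrK_eq_zero_of_odd K hodd, mul_zero, eq_comm]
    refine sum_eq_zero fun A _ => ?_
    by_cases hpar : Even #(Z'.filter (· ∈ A))
    · have hodd' : Odd #(Z'.filter (· ∉ A)) := by
        have hsum := Finset.card_filter_add_card_filter_not (s := Z') (fun v => v ∈ A)
        rcases hodd with ⟨k, hk⟩
        rcases hpar with ⟨j, hj⟩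
        exact Nat.odd_iff.2 (by omega)
      rw [corrK_eq_zero_of_odd _ hodd']; ring
    · rw [if_neg hpar]; ring

end Current

end Literature.Probability.LatticeModels

end
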